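/-
Copyright (c) 2026. All rights reserved.
Released under Apache 2.0 license as described in the file LICENSE.
Authors: abc-iut cell, seat abc-iut-f-069 (gen 3; row «P13-ZHAT-TRANSPORT»).
-/
import Literature.AnabelianGeometry.AbsoluteAnabelian.AbsTopII.DPSCIndexDataOfEmbeddingProofs
import Literature.AnabelianGeometry.AbsoluteAnabelian.AbsTopII.DPSCDataOfOuterActionInertia
import Literature.AnabelianGeometry.AbsoluteAnabelian.FreeProcyclicModel

/-!
# [AbsTopII] Prop 1.3 (iii) at `Π_𝒢 ⋊^out_θ J`: "`I_v ≅ I`" as topological groups, and "`I_v ≅ Ẑ^Σ`"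
# from "`I ≅ Ẑ^Σ`"

S. Mochizuki, *Topics in Absolute Anabelian Geometry II* [AbsTopII] (bib `MochizukiAbsTopII2013`; kurims
manuscript `paper:url-585b8d0ad0d9`), §1 Def 1.2 (ii) p. 10 ("`ι : I ↪ H` a continuous injection of
profinite groups with normal image", "`Π_I := Π_𝔾 ⋊^out I`"), Prop 1.3 (iii) p. 11: "we have a natural
isomorphism `I_v ≅ I`, … as abstract profinite groups, `I_v ≅ Ẑ^Σ`"; Ex 1.1 (i) p. 8 (`I ≅ Ẑ^Σ` for the
log point).

PROOF-ONLY sequel of `AbsTopII/DPSCIndexDataOfEmbeddingProofs.lean` (abc-iut-f-069, p442486) over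
abc-iut-w5-d226's `DPSCData.ofOuterAction` / abc-iut-w5-d151's `outerSemidirectProfinite` and
abc-iut-L4-t6's `IsFreeProSigmaCyclic`.  The last `Π_I`-level input of the (iii)′ closers, "`I_v ≅ Ẑ^Σ`"
(`IsFreeProSigmaCyclic Σ ↥I_v`), is RE-KEYED to the construction data: PROVED here, at the constructed
DPSC-extension `Π_𝒢 ⋊^out_θ J` with inertia subgroup `I ⊆ J` CLOSED,

* `DPSCData.isClosed_Iv_ofOuterAction` — `I_v = Z_{Π_I}(Π_v)` is closed;
* `DPSCData.exists_IvEquiv_ofOuterAction` — **"the natural isomorphism `I_v ⥲ I`" as an isomorphism of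
  TOPOLOGICAL groups** over the projection `Π_H ↠ J`, from t4's typed first clause `Prop13iii`
  (`I_v ∩ Π_𝔾 = {1}`: injective; `I_v · Π_𝔾 = Π_I`: surjective; compact → Hausdorff: homeomorphism);
* `DPSCData.isFreeProSigmaCyclic_Iv_ofOuterAction` — "`I_v ≅ Ẑ^Σ`" from "`I ≅ Ẑ^Σ`"
  (`IsFreeProSigmaCyclic.of_continuousMulEquiv`);
* `DPSCIndexData.prop_1_3_iii'_ofOuterAction_of_dehn` — **[AbsTopII] Prop 1.3 (iii) (rest) AS TYPED
  (F-0299) at `Π_𝒢 ⋊^out_θ J` from hypotheses on the CONSTRUCTION DATA only**: [CombGC] Prop 1.2 (ii)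
  for `G` (F-0438), slimness of the verticial subgroups (Rmk 1.1.3), `ρ_I` of profinite-Dehn-twist type
  (Π_v-fixing lifts), `I` closed with `I ≅ Ẑ^Σ`.
HONEST FRAMING: classical group theory / point-set topology; typed ≠ proved for the named inputs; nothing
here bears on [IUTchIII] Cor 3.12 or takes a side on any author.
-/

noncomputable section

open scoped Pointwise

namespace Literature.AnabelianGeometry.AbsoluteAnabelian

open Literature.AlgebraicGeometry.Frobenioids (IsSlimGroup)
open Literature.AnabelianGeometry.EtaleTheta (contMulAut mem_contMulAut TopOut innerContAut innerAut)
open Literature.AnabelianGeometry.SemiGraphs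
open Literature.AnabelianGeometry.Anabelioids (IsSigmaInteger)
open Topology

universe u

namespace DPSCData

section OuterAction

variable {P : Type u} [Group P] [TopologicalSpace P] [IsTopologicalGroup P] [CompactSpace P]
  [TotallyDisconnectedSpace P] (G : PSCDatum P) (hG : IsTopologicallyFinitelyGenerated P)
  {J : Type u} [Group J] [TopologicalSpace J] [IsTopologicalGroup J] [CompactSpace J]
  [TotallyDisconnectedSpace J] (θ : J →ₜ* outProfinite hG) (I : Subgroup J) [I.Normal]

/-- `I_v = Z_{Π_I}(Π_v) = Z_{Π_H}(Π_v) ∩ Π_I` is CLOSED in `Π_H = Π_𝒢 ⋊^out_θ J` as soon as `I ⊆ J` is closed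
(Def 1.2 (ii): "`ι : I ↪ H` a continuous injection of profinite groups"): a centraliser is closed in a
Hausdorff topological group, and `Π_I = snd⁻¹(I)`. [cite: MochizukiAbsTopII2013, Def 1.2 (ii) p.10] -/
theorem isClosed_Iv_ofOuterAction (hIc : IsClosed (I : Set J)) (v : (ofOuterAction G hG θ I).Vert) :
    IsClosed ((ofOuterAction G hG θ I).Iv v : Set (ofOuterAction G hG θ I).PiH) := by
  show IsClosed (((Subgroup.centralizer _ ⊓ (ofOuterAction G hG θ I).PiI :
    Subgroup (ofOuterAction G hG θ I).PiH)) : Set (ofOuterAction G hG θ I).PiH)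
  rw [Subgroup.coe_inf]
  exact (Set.isClosed_centralizer _).inter (hIc.preimage (sndProfinite hG θ).continuous)

/-- **"We have a natural isomorphism `I_v ⥲ I`" as TOPOLOGICAL groups** (Prop 1.3 (iii) p. 11; proof
p. 13: "`I_v ∩ Π_𝔾 = {1}`, so we obtain a natural injection `I_v ↪ I` … this injection is, in fact,
surjective"), at `Π_𝒢 ⋊^out_θ J` with `I` closed: the projection `Π_H ↠ J` restricts to a continuous
bijective homomorphism `I_v → I` (injective by `I_v ∩ Π_𝔾 = {1}`, surjective by `I_v · Π_𝔾 = Π_I` — t4's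
typed `Prop13iii`), from the compact `I_v` to the Hausdorff `I`, hence an isomorphism of topological
groups. [cite: MochizukiAbsTopII2013, Prop 1.3 (iii) p.11] -/
theorem exists_IvEquiv_ofOuterAction (hIc : IsClosed (I : Set J))
    (h13 : (ofOuterAction G hG θ I).Prop13iii) (v : (ofOuterAction G hG θ I).Vert) :
    ∃ e : ↥((ofOuterAction G hG θ I).Iv v) ≃ₜ* ↥I,
      ∀ x : ↥((ofOuterAction G hG θ I).Iv v), (e x).1 = sndProfinite hG θ x.1 := by
  haveI : (ofOuterAction G hG θ I).PiG.Normal := (ofOuterAction G hG θ I).normal_PiG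
  -- the homomorphism `I_v → I`, `x ↦ snd x` (`I_v ⊆ Π_I = snd⁻¹(I)`)
  let f : ↥((ofOuterAction G hG θ I).Iv v) →* ↥I :=
    (((sndProfinite hG θ).toMonoidHom.restrict ((ofOuterAction G hG θ I).Iv v)).codRestrict I
      fun x => x.2.2)
  have hf : ∀ x, (f x).1 = sndProfinite hG θ x.1 := fun _ => rfl
  -- injective: `I_v ∩ Π_𝔾 = {1}` and `Π_𝔾 = ker(snd)`
  have hinj : Function.Injective f := by
    refine (injective_iff_map_eq_one f).mpr fun x hx => ?_
    have hx1 : sndProfinite hG θ x.1 = 1 := by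
      rw [← hf x, hx]; rfl
    have hxG : x.1 ∈ (ofOuterAction G hG θ I).PiG := by
      show x.1 ∈ (inlProfinite hG θ).toMonoidHom.range
      rw [range_inlProfinite_eq_ker]
      exact hx1
    have hbot : x.1 ∈ (ofOuterAction G hG θ I).Iv v ⊓ (ofOuterAction G hG θ I).PiG := ⟨x.2, hxG⟩
    rw [(h13 v).1, Subgroup.mem_bot] at hbot
    exact Subtype.ext hbot
  -- surjective: `I_v · Π_𝔾 = Π_I`, `snd` surjective, `snd(Π_𝔾) = 1`
  have hsurj : Function.Surjective f := by
    intro i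
    obtain ⟨y₀, hy₀⟩ := sndProfinite_surjective hG θ (i : J)
    obtain ⟨y, rfl⟩ : ∃ y : (ofOuterAction G hG θ I).PiH, y = y₀ := ⟨y₀, rfl⟩
    have hyI : y ∈ (ofOuterAction G hG θ I).PiI := by
      show sndProfinite hG θ y ∈ I
      rw [hy₀]; exact i.2
    rw [← (h13 v).2, Subgroup.mem_sup_of_normal_right] at hyI
    obtain ⟨a, ha, g, hg, rfl⟩ := hyI
    refine ⟨⟨a, ha⟩, Subtype.ext ?_⟩
    have hg1 : sndProfinite hG θ g = 1 := by
      have hg' : g ∈ (inlProfinite hG θ).toMonoidHom.range := hg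
      rw [range_inlProfinite_eq_ker] at hg'
      exact hg'
    have hmul : sndProfinite hG θ (a * g) = sndProfinite hG θ a * sndProfinite hG θ g := map_mul _ _ _
    rw [hf, ← hy₀, hmul, hg1, mul_one]
  -- continuous, compact source, Hausdorff target
  have hfc : Continuous f :=
    ((sndProfinite hG θ).continuous.comp continuous_subtype_val).subtype_mk _
  haveI : CompactSpace ↥((ofOuterAction G hG θ I).Iv v) :=
    isCompact_iff_compactSpace.mp (isClosed_Iv_ofOuterAction G hG θ I hIc v).isCompact
  let fe : ↥((ofOuterAction G hG θ I).Iv v) ≃ ↥I := Equiv.ofBijective f ⟨hinj, hsurj⟩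
  have hfec : Continuous fe := hfc
  let h : ↥((ofOuterAction G hG θ I).Iv v) ≃ₜ ↥I := hfec.homeoOfEquivCompactToT2
  exact ⟨{ f with
      toFun := fe, invFun := fe.symm, left_inv := fe.left_inv, right_inv := fe.right_inv,
      continuous_toFun := hfec, continuous_invFun := h.continuous_symm }, fun x => rfl⟩

/-- **"as abstract profinite groups, `I_v ≅ Ẑ^Σ`"** (Prop 1.3 (iii) p. 11) at `Π_𝒢 ⋊^out_θ J` FROM "`I ≅ Ẑ^Σ`"
(Ex 1.1 (i): the inertia group of the log point), transported along `I_v ≃ₜ* I`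
(`exists_IvEquiv_ofOuterAction`, abc-iut-L4-t6-lineage's `IsFreeProSigmaCyclic.of_continuousMulEquiv`).
[cite: MochizukiAbsTopII2013, Prop 1.3 (iii) p.11] -/
theorem isFreeProSigmaCyclic_Iv_ofOuterAction {S : Set ℕ} (hIc : IsClosed (I : Set J))
    (h13 : (ofOuterAction G hG θ I).Prop13iii) (hI : AbsTopII.IsFreeProSigmaCyclic S ↥I)
    (v : (ofOuterAction G hG θ I).Vert) :
    AbsTopII.IsFreeProSigmaCyclic S ↥((ofOuterAction G hG θ I).Iv v) := by
  obtain ⟨e, -⟩ := exists_IvEquiv_ofOuterAction G hG θ I hIc h13 v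
  exact hI.of_continuousMulEquiv e.symm

end OuterAction

end DPSCData

/-! ## The (iii)′ closer with every input on the construction data -/

namespace AbsTopII.DPSCIndexData

section OuterAction

variable {P : Type u} [Group P] [TopologicalSpace P] [IsTopologicalGroup P] [CompactSpace P]
  [TotallyDisconnectedSpace P] (G : PSCDatum P) (hG : IsTopologicallyFinitelyGenerated P)
  (hZ : Subgroup.center P = ⊥)
  {J : Type u} [Group J] [TopologicalSpace J] [IsTopologicalGroup J] [CompactSpace J]
  [TotallyDisconnectedSpace J] (θ : J →ₜ* outProfinite hG) (I : Subgroup J) [I.Normal]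
  (σ : G.graph.N → ℕ) (hσ : ∀ e, IsSigmaInteger G.Sigma (σ e))

include hZ

/-- **[AbsTopII] Prop 1.3 (iii) (rest) AS TYPED (F-0299, `DPSCIndexData.Prop_1_3_iii'`) at the
DPSC-extension `Π_𝒢 ⋊^out_θ J` of construction data, from hypotheses on the construction data ONLY**:
[CombGC] Prop 1.2 (ii) for `G` (L3's `VerticialEdgeLikeCommensurablyTerminal`, F-0438); slimness of `G`'s
verticial subgroups ([CombGC] Rmk 1.1.3); `ρ_I = θ|_I` of profinite-Dehn-twist type (every `i ∈ I` has,
per vertex, a bi-continuous lift fixing `Π_v` pointwise — [CbTpII] Def 4.4); the inertia subgroup `I ⊆ J`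
closed and "`≅ Ẑ^Σ`" (Ex 1.1 (i)).  Assembled from `prop_1_3_iii'_ofOuterAction_of_fixingLifts` (cusp
input and "`I_v ↠ I`" discharged), abc-iut-w5-d226's `prop13iii_ofOuterAction_of_fixing_lifts` (the
decl OF RECORD for "`I_v ↠ I` ⟸ Π_v-fixing lifts", `AbsTopII/DPSCDataOfOuterActionInertia.lean` p441781,
of which `DPSCData.prop13iii_ofOuterAction_of_fixingLifts` in `DPSCIndexDataOfEmbeddingProofs.lean` is an
independent twin) and `isFreeProSigmaCyclic_Iv_ofOuterAction` ("`I_v ≅ Ẑ^Σ`" discharged).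
[cite: MochizukiAbsTopII2013, Prop 1.3 (iii) p.11] [cite: MochizukiCombGC2007, Prop 1.2 p.8] -/
theorem prop_1_3_iii'_ofOuterAction_of_dehn
    (hCT : G.VerticialEdgeLikeCommensurablyTerminal) (hslimv : ∀ w, IsSlimGroup ↥(G.vertGp w))
    (hDehn : ∀ (v : G.graph.V) (i : J), i ∈ I → ∃ φ : P ≃ₜ* P,
      TopOut.mk P ⟨φ.toMulEquiv, (mem_contMulAut P).mpr ⟨φ.continuous, φ.symm.continuous⟩⟩ =
        outerActionOfContinuous hG θ i ∧ ∀ x ∈ G.vertGp v, φ x = x)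
    (hIc : IsClosed (I : Set J)) (hI : IsFreeProSigmaCyclic G.Sigma ↥I) :
    Literature.AnabelianGeometry.AbsoluteAnabelian.AbsTopII.DPSCIndexData.Prop_1_3_iii'
      (ofOuterAction G hG θ I σ hσ) :=
  prop_1_3_iii'_ofOuterAction_of_fixingLifts G hG hZ θ I σ hσ hCT hslimv hDehn
    (DPSCData.isFreeProSigmaCyclic_Iv_ofOuterAction G hG θ I hIc
      (DPSCData.prop13iii_ofOuterAction_of_fixing_lifts G hG hZ θ I hCT hslimv hDehn) hI)

end OuterAction

end AbsTopII.DPSCIndexData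

end Literature.AnabelianGeometry.AbsoluteAnabelian

end
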